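import Summits.QuantumAdvantage.QuantumAdvantage.Theorems.SosSandwichTransferPBEventOSMFields
import Literature.Computability.QuantumComplexity.FactoringNP
import HarnessLib

/-!
# Crux `TransferPB` (stmt-QuantumAdvantage-15238, route SosSandwich), line `birth` — the brick programs CODE the event machine

Representation theorems for the three brick programs of `Theorems/SosSandwichTransferPBEventOSMDefs.lean` against the
event machine of `Theorems/SosSandwichTransferPBEventMachineDefs.lean` (field lemmas: `…EventOSMFields.lean`):

* **`kapF_encSt`** — `kapF ⟨x, encSt s⟩` is the code of `evKappa x s` (`0 q` / `1 b`), for EVERY state;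
* **`iniF_apply`** — `iniF pd x = encSt (evInit (pd |x|))`;
* the pieces: `finNone_apply`, `finishB_apply`, `memU_apply` (membership among the revealed strings, `Brick.anyFn`),
  `newB_apply` (the running `List.argmin strNum` = `bump`, comparing `u·1`, `c·1` by value: `strNum_add_one`),
  `proceedF_apply`, `nChild_apply`, `newP_apply`, `newU_apply`, `delRoot_apply`, …, `delMeans_apply`;
* **`del0_encSt`** — `del0 pw ⟨x, ⟨encSt s, [b]⟩⟩ = encSt (evDelta (pw |x|) s b)`, for EVERY state (no size hypothesis:
  only the cap of `delF` needs one, `Theorems/SosSandwichTransferPBEventOSMFinal.lean`).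

All proved; no named fact. Sources: S. Arora, B. Barak, Computational Complexity (CUP 2009), §3.4, §1.3; S. Aaronson,
A. Ambainis, Theory Comput. 10 (2014), proof of Thm. 23 (p. 14).
-/

-- D-0017: single-conjunct summit ⇒ the duplicate `QuantumAdvantage.QuantumAdvantage` is mandated.
set_option linter.dupNamespace false

noncomputable section

namespace Summit.QuantumAdvantage.QuantumAdvantage.Cruxes.TransferPB.Birth

open Finset Literature.Computability.Cryptography Literature.Computability.Complexity
  Literature.Computability.QuantumComplexity Literature.Computability.QuantumComplexity.ClassicalSimulation
open Brick Plumb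

namespace SimTreePB

namespace EvOSM

section Kap

variable (x : List Bool)

/-- **The action map codes `evKappa`.** [folklore] -/
theorem kapF_encSt (s : EvState) :
    kapF (boolPair x (encSt s)) = Sum.elim (fun q => false :: q) (fun b => [true, b]) (evKappa x s) := by
  rcases s with ⟨π, d, phase⟩
  cases phase with
  | root =>
    simp only [encSt, kapF, iteFn_of_oneBit (oneBit_isC _ _), isC_apply, kF_zero, tRoot]
    simp [qryG, encBlockS, evKappa]
  | single lv alive next best =>
    simp only [encSt, kapF, iteFn_of_oneBit (oneBit_isC _ _), iteFn_of_oneBit (oneBit_nilT _), isC_apply, nilT_apply,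
      isNilFn, kF_zero, kF_five, tRoot, tSingle]
    rcases alive with _ | ⟨u, rest⟩
    · simp [evKappa]
    · simp [qryG, encSingleS, evKappa, encList_cons, OracleCompose.boolPair_ne_nil]
  | block0 lv alive next best =>
    simp only [encSt, kapF, iteFn_of_oneBit (oneBit_isC _ _), iteFn_of_oneBit (oneBit_nilT _), isC_apply, nilT_apply,
      isNilFn, kF_zero, kF_five, tRoot, tSingle, tBlock0]
    rcases alive with _ | ⟨u, rest⟩
    · simp [evKappa]
    · simp [qryG, encBlockS, evKappa, encList_cons, OracleCompose.boolPair_ne_nil]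
  | block1 lv alive next best =>
    simp only [encSt, kapF, iteFn_of_oneBit (oneBit_isC _ _), iteFn_of_oneBit (oneBit_nilT _), isC_apply, nilT_apply,
      isNilFn, kF_zero, kF_five, tRoot, tSingle, tBlock0, tBlock1]
    rcases alive with _ | ⟨u, rest⟩
    · simp [evKappa]
    · simp [qryG, encBlockS, evKappa, encList_cons, OracleCompose.boolPair_ne_nil]
  | aq u =>
    simp only [encSt, kapF, iteFn_of_oneBit (oneBit_isC _ _), isC_apply, kF_zero, tRoot, tSingle, tBlock0, tBlock1, tAq]
    simp [evKappa]
  | means j cnt =>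
    simp only [encSt, kapF, iteFn_of_oneBit (oneBit_isC _ _), isC_apply, kF_zero, tRoot, tSingle, tBlock0, tBlock1, tAq,
      tMeans]
    simp [qryG, encMeanS, evKappa, ones]
  | done c =>
    simp only [encSt, kapF, iteFn_of_oneBit (oneBit_isC _ _), isC_apply, kF_zero, tRoot, tSingle, tBlock0, tBlock1, tAq,
      tMeans, tDone]
    simp [evKappa]

/-- **The initial map codes `evInit (pd |x|)`.** [folklore] -/
theorem iniF_apply (pd : Polynomial ℕ) : iniF pd x = encSt (evInit (pd.eval x.length)) := by
  simp only [iniF, iteFn_of_oneBit (oneBit_nilT _), nilT_apply, isNilFn, polyFn_apply, ones, List.replicate_eq_nil_iff, mk8_apply, evInit]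
  rcases h : pd.eval x.length with _ | D
  · simp [roundState, encSt, rec8, encPathS, ones]
  · simp [roundState, encSt, rec8, encPathS]

end Kap


section Del

variable (x : List Bool) (π : List (List Bool × Bool)) (d : ℕ) (b : Bool)

/-- The answer-bit test is one-bit. [folklore] -/
theorem oneBit_bitT : OneBit bitT := oneBit_isC _ _

/-- Value of `finNone`: the code of `finish π d none`. [folklore] -/
theorem finNone_apply (a₀ a₃ a₄ a₅ a₆ a₇ : List Bool) :
    finNone (dArg x (rec8 a₀ (encPathS π) (encList (π.map Prod.fst)) a₃ a₄ a₅ a₆ a₇) b) = encSt (finish π d none) := by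
  simp [finNone, finish, encSt, ones]

/-- Value of `finishB`: the code of `finish π d best`. [folklore] -/
theorem finishB_apply {Bf : List Bool → List Bool} {best : Option (List Bool)} (a₀ a₄ a₅ a₆ a₇ : List Bool)
    (hBf : Bf (dArg x (rec8 a₀ (encPathS π) (encList (π.map Prod.fst)) (ones d) a₄ a₅ a₆ a₇) b) = encOpt best) :
    finishB Bf (dArg x (rec8 a₀ (encPathS π) (encList (π.map Prod.fst)) (ones d) a₄ a₅ a₆ a₇) b) =
      encSt (finish π d best) := by
  rw [finishB, iteFn_of_oneBit (oneBit_nilT _), nilT_apply, isNilFn, hBf]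
  cases best with
  | none => simp [encOpt, finNone_apply x π d b]
  | some c => simp [encOpt, hBf, finish, encSt, Function.comp_apply]

/-- The live string at hand and the rest of the level, read off the `A` field. [folklore] -/
@[simp] theorem hdA_dArg (a₀ a₁ a₂ a₃ a₄ a₆ a₇ u : List Bool) (rest : List (List Bool)) :
    hdA (dArg x (rec8 a₀ a₁ a₂ a₃ a₄ (encList (u :: rest)) a₆ a₇) b) = u := by
  simp [hdA, encList_cons]

/-- The rest of the level, read off the `A` field. [folklore] -/
@[simp] theorem tlA_dArg (a₀ a₁ a₂ a₃ a₄ a₆ a₇ u : List Bool) (rest : List (List Bool)) :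
    tlA (dArg x (rec8 a₀ a₁ a₂ a₃ a₄ (encList (u :: rest)) a₆ a₇) b) = encList rest := by
  simp [tlA, encList_cons]

/-- **Value of the membership test**: `[u ∈ revealed strings]`. [folklore] -/
theorem memU_apply (a₀ a₁ a₃ a₄ a₆ a₇ u : List Bool) (rest used : List (List Bool)) :
    memU (dArg x (rec8 a₀ a₁ (encList used) a₃ a₄ (encList (u :: rest)) a₆ a₇) b) = [decide (u ∈ used)] := by
  rw [memU, Function.comp_apply, fanoutFn_apply, hdA_dArg, dF_two, anyFn_boolPair oneBit_eqPairFn, decNil_encList]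
  simp [eqPairFn_boolPair]

/-- The canonical numerals compare as `strNum`. [folklore] -/
theorem bitsToNat_append_true_lt_iff (u c : List Bool) :
    bitsToNat (u ++ [true]) < bitsToNat (c ++ [true]) ↔ strNum u < strNum c := by
  rw [← strNum_add_one, ← strNum_add_one]; omega

/-- **Value of the candidate update**: the code of `bump π b best u`. [folklore] -/
theorem newB_apply (a₀ a₁ a₃ a₄ a₆ u : List Bool) (rest : List (List Bool)) (best : Option (List Bool)) :
    newB (dArg x (rec8 a₀ a₁ (encList (π.map Prod.fst)) a₃ a₄ (encList (u :: rest)) a₆ (encOpt best)) b) =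
      encOpt (bump π b best u) := by
  have hc : andFn bitT (notFn memU)
      (dArg x (rec8 a₀ a₁ (encList (π.map Prod.fst)) a₃ a₄ (encList (u :: rest)) a₆ (encOpt best)) b) =
      [b && !decide (u ∈ π.map Prod.fst)] :=
    andFn_apply (bitT_dArg x b _) (notFn_apply (memU_apply x b _ _ _ _ _ _ u rest _))
  rw [newB, iteFn_apply hc, bump]
  by_cases h : b = true ∧ u ∉ π.map Prod.fst
  · obtain ⟨rfl, hu⟩ := h
    rw [if_pos (by simp [hu]), if_pos ⟨rfl, hu⟩, iteFn_of_oneBit (oneBit_nilT _), nilT_apply, isNilFn, dB_dArg]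
    cases best with
    | none => simp [encOpt, better]
    | some c =>
      rw [if_neg (by simp [encOpt]), iteFn_of_oneBit (oneBit_ltFn.comp _), Function.comp_apply, fanoutFn_apply]
      simp only [app1, hdA_dArg, Function.comp_apply, dB_dArg, encOpt, List.tail_cons, ltFn_boolPair,
        bitsToNat_append_true_lt_iff, better]
      split_ifs with h1 h2 h2 <;> simp_all
  · rw [if_neg h, if_neg, dB_dArg]
    cases b <;> simp_all

/-- **Value of `proceedF`**: the code of `proceed π d lv rest next best`. [folklore] -/
theorem proceedF_apply {Lf Rf Nf Bf : List Bool → List Bool} {lv : ℕ} {rest next : List (List Bool)}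
    {best : Option (List Bool)} (a₀ a₄ a₅ a₆ a₇ : List Bool)
    (hL : Lf (dArg x (rec8 a₀ (encPathS π) (encList (π.map Prod.fst)) (ones d) a₄ a₅ a₆ a₇) b) = ones lv)
    (hR : Rf (dArg x (rec8 a₀ (encPathS π) (encList (π.map Prod.fst)) (ones d) a₄ a₅ a₆ a₇) b) = encList rest)
    (hN : Nf (dArg x (rec8 a₀ (encPathS π) (encList (π.map Prod.fst)) (ones d) a₄ a₅ a₆ a₇) b) = encList next)
    (hB : Bf (dArg x (rec8 a₀ (encPathS π) (encList (π.map Prod.fst)) (ones d) a₄ a₅ a₆ a₇) b) = encOpt best) :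
    proceedF Lf Rf Nf Bf (dArg x (rec8 a₀ (encPathS π) (encList (π.map Prod.fst)) (ones d) a₄ a₅ a₆ a₇) b) =
      encSt (proceed π d lv rest next best) := by
  rw [proceedF, iteFn_of_oneBit (oneBit_nilT _), nilT_apply, isNilFn, hR]
  rcases rest with _ | ⟨w, rest⟩
  · rw [if_pos (by simp), iteFn_of_oneBit (oneBit_nilT _), nilT_apply, isNilFn, hL]
    rcases lv with _ | lv
    · rw [if_pos (by simp)]
      exact finishB_apply x π d b a₀ a₄ a₅ a₆ a₇ hB
    · rw [if_neg (by simp), iteFn_of_oneBit (oneBit_nilT _), nilT_apply, isNilFn, hN]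
      rcases next with _ | ⟨v, next⟩
      · rw [if_pos (by simp)]
        exact finishB_apply x π d b a₀ a₄ a₅ a₆ a₇ hB
      · rw [if_neg (by simp [encList_eq_nil_iff]), mk8_apply, dF_one, dF_two, dF_three, Function.comp_apply, hL, hN, hB]
        rfl
  · rw [if_neg (by simp [encList_cons, boolPair]), mk8_apply, dF_one, dF_two, dF_three, hL, hR, hN, hB]
    rfl

/-- **Value of the child collection**: the `N` field after a BLOCK answer. [folklore] -/
theorem nChild_apply (b₀ : Bool) (a₀ a₁ a₂ a₃ a₄ a₇ u : List Bool) (rest next : List (List Bool)) :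
    nChild b₀ (dArg x (rec8 a₀ a₁ a₂ a₃ a₄ (encList (u :: rest)) (encList next) a₇) b) =
      encList (if b = true then next ++ [u ++ [b₀]] else next) := by
  rw [nChild, iteFn_of_oneBit oneBit_bitT, bitT_dArg]
  cases b
  · simp
  · rw [if_pos rfl, if_pos rfl]
    show dF 6 _ ++ boolPair (hdA _ ++ [b₀]) [] = _
    rw [hdA_dArg, dF_six, encList_append, encList_cons, encList_nil]

/-- Value of the new serialised path after the `A`-answer. [folklore] -/
theorem newP_apply (a₀ a₃ a₄ a₆ a₇ u : List Bool) :
    newP (dArg x (rec8 a₀ (encPathS π) (encList (π.map Prod.fst)) a₃ a₄ u a₆ a₇) b) = encPathS (π ++ [(u, b)]) := by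
  simp [newP, encPathS_append_singleton]

/-- Value of the new code of the revealed strings after the `A`-answer. [folklore] -/
theorem newU_apply (a₀ a₃ a₄ a₆ a₇ u : List Bool) :
    newU (dArg x (rec8 a₀ (encPathS π) (encList (π.map Prod.fst)) a₃ a₄ u a₆ a₇) b) =
      encList ((π ++ [(u, b)]).map Prod.fst) := by
  simp [newU, appendItem, encList_append, encList_cons]

/-- Transition at `root`. [folklore] -/
theorem delRoot_apply (pw : Polynomial ℕ) :
    delRoot pw (dArg x (encSt ⟨π, d, .root⟩) b) = encSt (evDelta (pw.eval x.length) ⟨π, d, .root⟩ b) := by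
  have hδ : evDelta (pw.eval x.length) ⟨π, d, .root⟩ b = if pw.eval x.length = 0 then finish π d none
      else if b = true then ⟨π, d, .single (pw.eval x.length - 1) [[]] [] none⟩ else finish π d none := rfl
  rw [hδ, encSt, delRoot, iteFn_of_oneBit (oneBit_nilT _), nilT_apply, isNilFn]
  simp only [wOnes, Function.comp_apply, dX_dArg, polyFn_apply, ones, List.replicate_eq_nil_iff]
  by_cases hW : pw.eval x.length = 0
  · rw [if_pos (by simp [hW]), if_pos hW, finNone_apply x π d b]
  · rw [if_neg (by simp [hW]), if_neg hW, iteFn_of_oneBit oneBit_bitT, bitT_dArg]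
    cases b with
    | true =>
      rw [if_pos rfl, if_pos rfl, mk8_apply]
      simp [encSt, encList_cons, encOpt, Function.comp_apply, polyFn_apply]
    | false =>
      rw [if_neg (by simp), if_neg (by simp), finNone_apply x π d false]

/-- Transition at `single`. [folklore] -/
theorem delSingle_apply (lv : ℕ) (alive next : List (List Bool)) (best : Option (List Bool)) (W : ℕ) :
    delSingle (dArg x (encSt ⟨π, d, .single lv alive next best⟩) b) =
      encSt (evDelta W ⟨π, d, .single lv alive next best⟩ b) := by
  rw [encSt, delSingle, iteFn_of_oneBit (oneBit_nilT _), nilT_apply, isNilFn, dF_five]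
  rcases alive with _ | ⟨u, rest⟩
  · rw [if_pos (by simp), dSt_dArg]
    rcases lv with _ | lv <;> rfl
  · rw [if_neg (by simp [encList_eq_nil_iff]), iteFn_of_oneBit (oneBit_nilT _), nilT_apply, isNilFn, dF_four]
    rcases lv with _ | lv
    · rw [if_pos (by simp)]
      exact proceedF_apply x π d b _ _ _ _ _ (dF_four ..) (tlA_dArg ..) (dF_six ..) (newB_apply x π b _ _ _ _ _ u rest best)
    · rw [if_neg (by simp), mk8_apply, dF_one, dF_two, dF_three, dF_four, dF_five, dF_six,
        newB_apply x π b _ _ _ _ _ u rest best]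
      rfl

/-- Transition at `block0`. [folklore] -/
theorem delBlock0_apply (lv : ℕ) (alive next : List (List Bool)) (best : Option (List Bool)) (W : ℕ) :
    delBlock0 (dArg x (encSt ⟨π, d, .block0 lv alive next best⟩) b) =
      encSt (evDelta W ⟨π, d, .block0 lv alive next best⟩ b) := by
  rw [encSt, delBlock0, iteFn_of_oneBit (oneBit_nilT _), nilT_apply, isNilFn, dF_five]
  rcases alive with _ | ⟨u, rest⟩
  · rw [if_pos (by simp), dSt_dArg]; rfl
  · rw [if_neg (by simp [encList_eq_nil_iff]), mk8_apply, dF_one, dF_two, dF_three, dF_four, dF_five, dB_dArg, nChild_apply]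
    rfl

/-- Transition at `block1`. [folklore] -/
theorem delBlock1_apply (lv : ℕ) (alive next : List (List Bool)) (best : Option (List Bool)) (W : ℕ) :
    delBlock1 (dArg x (encSt ⟨π, d, .block1 lv alive next best⟩) b) =
      encSt (evDelta W ⟨π, d, .block1 lv alive next best⟩ b) := by
  rw [encSt, delBlock1, iteFn_of_oneBit (oneBit_nilT _), nilT_apply, isNilFn, dF_five]
  rcases alive with _ | ⟨u, rest⟩
  · rw [if_pos (by simp), dSt_dArg]; rfl
  · rw [if_neg (by simp [encList_eq_nil_iff])]
    exact proceedF_apply x π d b _ _ _ _ _ (dF_four ..) (tlA_dArg ..) (nChild_apply ..) (dB_dArg ..)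

/-- Transition at `aq`. [folklore] -/
theorem delAq_apply (u : List Bool) (W : ℕ) :
    delAq (dArg x (encSt ⟨π, d, .aq u⟩) b) = encSt (evDelta W ⟨π, d, .aq u⟩ b) := by
  have hδ : evDelta W ⟨π, d, .aq u⟩ b = roundState (π ++ [(u, b)]) (d - 1) := rfl
  rw [hδ, encSt, delAq, iteFn_of_oneBit (oneBit_nilT _), nilT_apply, isNilFn]
  simp only [Function.comp_apply, dF_three, mk8_apply, newP_apply, newU_apply]
  rcases d with _ | d'
  · simp [roundState, encSt, ones]
  · rcases d' with _ | d''
    · simp [roundState, encSt, ones]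
    · simp [roundState, encSt, ones, List.replicate_succ]

/-- Transition at `means`. [folklore] -/
theorem delMeans_apply (j cnt W : ℕ) :
    delMeans (dArg x (encSt ⟨π, d, .means j cnt⟩) b) = encSt (evDelta W ⟨π, d, .means j cnt⟩ b) := by
  have hC : newC (dArg x (encSt ⟨π, d, .means j cnt⟩) b) = ones (if b = true then cnt + 1 else cnt) := by
    rw [newC, iteFn_of_oneBit oneBit_bitT, encSt, bitT_dArg]
    cases b <;> simp [ones, List.replicate_succ]
  have hδ : evDelta W ⟨π, d, .means j cnt⟩ b =
      if 40 ≤ j then ⟨π, d, .done (decide (20 ≤ (if b = true then cnt + 1 else cnt)))⟩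
      else ⟨π, d, .means (j + 1) (if b = true then cnt + 1 else cnt)⟩ := rfl
  rw [hδ, delMeans, iteFn_of_oneBit (oneBit_ltLenF.comp _)]
  simp only [Function.comp_apply, fanoutFn_apply, mk8_apply, hC, ltLenF_boolPair, ones, List.length_replicate]
  rw [encSt]
  simp only [dF_one, dF_two, dF_three, dF_four, ones, List.length_replicate]
  by_cases h40 : 40 ≤ j
  · rw [if_pos (by simp; omega), if_pos h40, encSt]
    congr 2
  · rw [if_neg (by simp; omega), if_neg h40, encSt]
    rfl

/-- **The uncapped transition codes `evDelta`** (width bound `W = pw(|x|)`), at every state. [folklore] -/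
theorem del0_encSt (pw : Polynomial ℕ) (s : EvState) :
    del0 pw (dArg x (encSt s) b) = encSt (evDelta (pw.eval x.length) s b) := by
  rcases s with ⟨π, d, phase⟩
  cases phase with
  | root =>
    rw [← delRoot_apply x π d b pw, del0, encSt]
    simp [iteFn_of_oneBit (oneBit_isC _ _), isC_apply, tRoot]
  | single lv alive next best =>
    rw [← delSingle_apply x π d b, del0, encSt]
    simp [iteFn_of_oneBit (oneBit_isC _ _), isC_apply, tRoot, tSingle]
  | block0 lv alive next best =>
    rw [← delBlock0_apply x π d b, del0, encSt]
    simp [iteFn_of_oneBit (oneBit_isC _ _), isC_apply, tRoot, tSingle, tBlock0]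
  | block1 lv alive next best =>
    rw [← delBlock1_apply x π d b, del0, encSt]
    simp [iteFn_of_oneBit (oneBit_isC _ _), isC_apply, tRoot, tSingle, tBlock0, tBlock1]
  | aq u =>
    rw [← delAq_apply x π d b, del0, encSt]
    simp [iteFn_of_oneBit (oneBit_isC _ _), isC_apply, tRoot, tSingle, tBlock0, tBlock1, tAq]
  | means j cnt =>
    rw [← delMeans_apply x π d b, del0, encSt]
    simp [iteFn_of_oneBit (oneBit_isC _ _), isC_apply, tRoot, tSingle, tBlock0, tBlock1, tAq, tMeans]
  | done c =>
    have hδ : evDelta (pw.eval x.length) ⟨π, d, .done c⟩ b = ⟨π, d, .done c⟩ := rfl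
    rw [hδ, del0, encSt]
    simp [iteFn_of_oneBit (oneBit_isC _ _), isC_apply, tRoot, tSingle, tBlock0, tBlock1, tAq, tMeans, tDone]

end Del

end EvOSM

end SimTreePB

end Summit.QuantumAdvantage.QuantumAdvantage.Cruxes.TransferPB.Birth

end
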